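import Summits.CriticalPhenomena.PercolationContinuityZ3.Theorems.FK.DecayRateMonotone
import Summits.CriticalPhenomena.PercolationContinuityZ3.Theorems.FK.BoxLimitJointSemicontinuity
import HarnessLib

/-!
# FK-continuity cell, FO-10a: the FREE inverse correlation length `ψ⁰(p,q)` is UPPER SEMICONTINUOUS in the vector `(p,q)`,
# hence LEFT-continuous in `p` and RIGHT-continuous in `q` (the random-cluster half of Grimmett 1999, Thm. (6.14) /
# (6.15): "`φ` is continuous and non-increasing on `(0,1]`", via Grimmett 2006 Prop. (4.28)(c) and (5.46))

Registered R121 (cell INBOX l.7722, 2026-08-26); registry row FO-10a-g343s; label CSZ-B (coordinator fk-4 g232).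
Cell `fk-continuity` (bschramm), row FO-10a; support file for the FK-continuity transplant
(`--supports stmt-CriticalPhenomena-4575`); builds on p205010 (kernel theorem, internal audit signed; external expert
review pending). Sequel of `RadiusDecayRate.lean` (Cor. (5.45): `ψ^b(p,q) = lim -n⁻¹ log φ^b_{p,q}(0 ↔ ∂Λ_n)` with
`φ^b(0 ↔ ∂Λ_n) ≤ 2d(2n+1)^{d-1} e^{-nψ}`), `DecayRateMonotone.lean` (`ψ` non-increasing in `p`, non-decreasing in
`q`) and `BoxLimitJointSemicontinuity.lean` (Prop. (4.28)(c) in the vector `(p,q)`). Pure proofs; no definitions, no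
named facts, no sorries. UNCONDITIONAL; decides nothing about the VALUE of `ψ` (nor continuity from the other sides,
nor anything about `ψ¹`).

The bound (5.46) turns the limit into an infimum: `ψ⁰(p,q) = inf_{n ≥ 1} g_n(p,q)`,
`g_n = n⁻¹ (log(2d(2n+1)^{d-1}) - log φ⁰_{p,q}(0 ↔ ∂Λ_n))`, and each `g_n` is upper semicontinuous in `(p,q)` because
the FREE radius law — the probability of an increasing LOCAL event — is lower semicontinuous (Prop. (4.28)(c), the
tree's `lowerSemicontinuousWithinAt_rcLimit_false_real`) and positive. An infimum of upper semicontinuous functions is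
upper semicontinuous; with the monotonicity of `DecayRateMonotone.lean` this gives one-sided continuity. (For the
wired measure the radius law is upper semicontinuous and the argument gives nothing.)

## Contents (namespace `Summit.CriticalPhenomena.PercolationContinuityZ3.Theorems.FK`)

* `upperSemicontinuousWithinAt_neg_log` — `f` lower semicontinuous at `x` with `f x > 0` ⇒ `-log ∘ f` upper
  semicontinuous at `x` (real analysis);
* `lowerSemicontinuousWithinAt_rcLimit_false_real_siteToBoundary` — the free radius law is jointly lsc in `(p,q)`;
* **`upperSemicontinuousWithinAt_radiusDecayRate_rcLimit_false`** — any function `Ψ` that agrees on the strip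
  `S = (0,1] × [1,∞)` with the free radius rate (`-n⁻¹ log φ⁰_{p,q}(0 ↔ ∂Λ_n) → Ψ(p,q)`) is upper semicontinuous
  within `S` at every point of `S`;
* **`continuousWithinAt_Icc_left_radiusDecayRate_rcLimit_false`** (left-continuity in `p`) and
  **`continuousWithinAt_Icc_right_radiusDecayRate_rcLimit_false_q`** (right-continuity in `q`).

## References

* G. Grimmett, *The Random-Cluster Model*, Springer 2006, Prop. (4.28)(c), Cor. (5.45), eq. (5.46), §5.5.
  [Grimmett2006]
* G. Grimmett, *Percolation*, 2nd ed., Springer 1999, §6.2 Thm. (6.14) eq. (6.15) (continuity of the percolation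
  radius rate). [GrimmettPercolation1999]
-/

noncomputable section

open MeasureTheory Set Filter
open scoped Topology

namespace Summit.CriticalPhenomena.PercolationContinuityZ3.Theorems.FK

open Literature.Probability.Percolation Literature.Probability.LatticeModels

/-! ### Real analysis: `-log` of a positive lower semicontinuous function is upper semicontinuous -/

/-- If `f` is lower semicontinuous within `s` at `x` and `f x > 0`, then `y ↦ -log (f y)` is upper semicontinuous
within `s` at `x`. [folklore] -/
theorem upperSemicontinuousWithinAt_neg_log {α : Type*} [TopologicalSpace α] {f : α → ℝ} {s : Set α} {x : α}
    (hf : LowerSemicontinuousWithinAt f s x) (hpos : 0 < f x) :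
    UpperSemicontinuousWithinAt (fun y => -Real.log (f y)) s x := by
  intro z hz
  -- `-log (f x) < z` ⟺ `exp (-z) < f x`
  have hx : Real.exp (-z) < f x := by
    rw [← Real.lt_log_iff_exp_lt hpos]; linarith
  filter_upwards [hf _ hx] with y hy
  have hypos : 0 < f y := (Real.exp_pos _).trans hy
  have h := (Real.lt_log_iff_exp_lt hypos).2 hy
  linarith

variable {d : ℕ}

/-- **The free radius law is jointly lower semicontinuous**: `(p,q) ↦ φ⁰_{p,q}(0 ↔ ∂Λ_n)` is lower semicontinuous
within `[0,1] × [1,∞)` (Prop. (4.28)(c) in the vector `(p,q)` applied to the increasing local event `{0 ↔ ∂Λ_n}`).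
[cite: Grimmett2006, Prop. (4.28)(c)] -/
theorem lowerSemicontinuousWithinAt_rcLimit_false_real_siteToBoundary (n : ℕ) {p₀ q₀ : ℝ}
    (hp₀ : p₀ ∈ Set.Icc (0 : ℝ) 1) (hq₀ : 1 ≤ q₀) :
    LowerSemicontinuousWithinAt (fun x : ℝ × ℝ => (rcLimit d false x.1 x.2).real (siteToBoundary d n))
      (Set.Icc (0 : ℝ) 1 ×ˢ Set.Ici (1 : ℝ)) (p₀, q₀) := by
  obtain ⟨K, hK⟩ := isLocalEvent_siteToBoundary d n
  exact lowerSemicontinuousWithinAt_rcLimit_false_real hK (DCT16.isUpperSet_siteToBoundary d n) hp₀ hq₀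

/-- **`ψ⁰(p,q)` is upper semicontinuous in the vector `(p,q)`** (`d ≥ 1`): let `Ψ` be any real function which, at
every point of the strip `S = (0,1] × [1,∞)`, is the limit `-n⁻¹ log φ⁰_{p,q}(0 ↔ ∂Λ_n) → Ψ(p,q)` (such limits exist:
`RadiusDecayRate.exists_radiusDecayRate_rcLimit`); then `Ψ` is upper semicontinuous within `S` at every point of `S`
(`Ψ = inf_n g_n` with `g_n` usc by (5.46) and Prop. (4.28)(c)). [cite: Grimmett2006, Cor. (5.45), eq. (5.46), Prop. (4.28)(c)] -/
theorem upperSemicontinuousWithinAt_radiusDecayRate_rcLimit_false (k : Fin d) {Ψ : ℝ × ℝ → ℝ}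
    (hΨ : ∀ x ∈ Set.Ioc (0 : ℝ) 1 ×ˢ Set.Ici (1 : ℝ), Tendsto (fun n : ℕ =>
      -Real.log ((rcLimit d false x.1 x.2).real (siteToBoundary d n)) / n) atTop (𝓝 (Ψ x)))
    {x₀ : ℝ × ℝ} (hx₀ : x₀ ∈ Set.Ioc (0 : ℝ) 1 ×ˢ Set.Ici (1 : ℝ)) :
    UpperSemicontinuousWithinAt Ψ (Set.Ioc (0 : ℝ) 1 ×ˢ Set.Ici (1 : ℝ)) x₀ := by
  have hd : 1 ≤ d := Nat.succ_le_of_lt (Fin.pos k)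
  -- notation
  set S : Set (ℝ × ℝ) := Set.Ioc (0 : ℝ) 1 ×ˢ Set.Ici (1 : ℝ) with hS
  set C : ℕ → ℝ := fun n => 2 * d * (2 * n + 1) ^ (d - 1) with hC
  set β : ℝ × ℝ → ℕ → ℝ := fun x n => (rcLimit d false x.1 x.2).real (siteToBoundary d n) with hβ
  have hmemS : ∀ {x : ℝ × ℝ}, x ∈ S → x.1 ∈ Set.Ioc (0 : ℝ) 1 ∧ 1 ≤ x.2 := fun hx => ⟨hx.1, hx.2⟩
  have hβpos : ∀ {x : ℝ × ℝ}, x ∈ S → ∀ n, 0 < β x n := fun hx n =>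
    rcLimit_real_siteToBoundary_pos false (hmemS hx).1 (hmemS hx).2 k n
  have hCpos : ∀ n, 0 < C n := fun n => by positivity
  -- Claim A: `Ψ x ≤ g_n x` on `S`, `n ≥ 1`
  have hA : ∀ {x : ℝ × ℝ}, x ∈ S → ∀ {n : ℕ}, 1 ≤ n →
      Ψ x ≤ (Real.log (C n) - Real.log (β x n)) / n := by
    intro x hx n hn
    obtain ⟨ψ, -, -, hlimR, -, hbdR⟩ := exists_radiusDecayRate_rcLimit (d := d) false (hmemS hx).1 (hmemS hx).2 k
    have heq : ψ = Ψ x := tendsto_nhds_unique hlimR (hΨ x hx)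
    have hn' : (0 : ℝ) < n := Nat.cast_pos.2 hn
    have h1 : Real.log (β x n) ≤ Real.log (C n) + -(n * ψ) := by
      rw [← Real.log_exp (-(n * ψ)), ← Real.log_mul (hCpos n).ne' (Real.exp_pos _).ne']
      exact Real.log_le_log (hβpos hx n) (hbdR n)
    rw [le_div_iff₀ hn', ← heq]
    linarith
  -- Claim B: `g_n x₀ → Ψ x₀`
  have hB : Tendsto (fun n : ℕ => (Real.log (C n) - Real.log (β x₀ n)) / n) atTop (𝓝 (Ψ x₀)) := by
    have h := (tendsto_log_card_bound_div hd).add (hΨ x₀ hx₀)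
    rw [zero_add] at h
    refine h.congr fun n => ?_
    simp only [hC, hβ]
    ring
  -- upper semicontinuity
  intro y hy
  obtain ⟨n, hn1, hny⟩ : ∃ n : ℕ, 1 ≤ n ∧ (Real.log (C n) - Real.log (β x₀ n)) / n < y := by
    have h := ((tendsto_order.1 hB).2 y hy).and (eventually_ge_atTop 1)
    obtain ⟨n, hn, hn1⟩ := h.exists
    exact ⟨n, hn1, hn⟩
  have hn' : (0 : ℝ) < n := Nat.cast_pos.2 hn1
  -- `x ↦ -log β x n` is usc within `S` at `x₀` (lsc within the larger strip, restricted)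
  have hlsc : LowerSemicontinuousWithinAt (fun x : ℝ × ℝ => β x n) S x₀ := by
    have h := lowerSemicontinuousWithinAt_rcLimit_false_real_siteToBoundary (d := d) n
      ⟨hx₀.1.1.le, hx₀.1.2⟩ hx₀.2
    intro z hz
    exact (h z hz).filter_mono (nhdsWithin_mono _ (Set.prod_mono Set.Ioc_subset_Icc_self subset_rfl))
  have husc := upperSemicontinuousWithinAt_neg_log hlsc (hβpos hx₀ n)
  -- threshold: `-log β x n < n y - log C_n` at `x₀`, hence nearby
  have hthr : -Real.log (β x₀ n) < n * y - Real.log (C n) := by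
    rw [div_lt_iff₀ hn'] at hny; linarith
  filter_upwards [husc _ hthr, self_mem_nhdsWithin] with x hx hxS
  calc Ψ x ≤ (Real.log (C n) - Real.log (β x n)) / n := hA hxS hn1
    _ < y := by rw [div_lt_iff₀ hn']; linarith

/-- **`ψ⁰(·,q₀)` is LEFT-continuous in `p`** on `(0,1]` (`q₀ ≥ 1`, `d ≥ 1`): upper semicontinuity plus the
non-increase in `p` (`DecayRateMonotone.lean`). [cite: Grimmett2006, Cor. (5.45), Prop. (4.28)(c); §5.5 (5.57)] -/
theorem continuousWithinAt_Icc_left_radiusDecayRate_rcLimit_false (k : Fin d) {Ψ : ℝ × ℝ → ℝ}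
    (hΨ : ∀ x ∈ Set.Ioc (0 : ℝ) 1 ×ˢ Set.Ici (1 : ℝ), Tendsto (fun n : ℕ =>
      -Real.log ((rcLimit d false x.1 x.2).real (siteToBoundary d n)) / n) atTop (𝓝 (Ψ x)))
    {a p₀ q₀ : ℝ} (ha : 0 < a) (hap : a ≤ p₀) (hp₀ : p₀ ≤ 1) (hq₀ : 1 ≤ q₀) :
    ContinuousWithinAt (fun p => Ψ (p, q₀)) (Set.Icc a p₀) p₀ := by
  -- `-Ψ(·,q₀)` is non-decreasing on `[a,1]` and lower semicontinuous there ⇒ left-continuous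
  have hmono : MonotoneOn (fun p => -Ψ (p, q₀)) (Set.Icc a 1) := by
    intro p hp p' hp' hpp'
    have hpS : p ∈ Set.Ioc (0 : ℝ) 1 := ⟨ha.trans_le hp.1, hp.2⟩
    have hp'S : p' ∈ Set.Ioc (0 : ℝ) 1 := ⟨ha.trans_le hp'.1, hp'.2⟩
    exact neg_le_neg (radiusDecayRate_rcLimit_anti_left false hpS ⟨hp'S.1.le, hp'S.2⟩ hpp' hq₀ k
      (hΨ (p, q₀) ⟨hpS, hq₀⟩) (hΨ (p', q₀) ⟨hp'S, hq₀⟩))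
  have hx : p₀ ∈ Set.Icc a 1 := ⟨hap, hp₀⟩
  have husc := upperSemicontinuousWithinAt_radiusDecayRate_rcLimit_false k hΨ (x₀ := (p₀, q₀))
    ⟨⟨ha.trans_le hap, hp₀⟩, hq₀⟩
  -- transport along the slice `p ↦ (p, q₀)`
  have hslice : Tendsto (fun p : ℝ => (p, q₀)) (𝓝[Set.Icc a 1] p₀)
      (𝓝[Set.Ioc (0 : ℝ) 1 ×ˢ Set.Ici (1 : ℝ)] (p₀, q₀)) := by
    refine tendsto_nhdsWithin_of_tendsto_nhds_of_eventually_within _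
      ((Continuous.prodMk_left q₀).tendsto p₀ |>.mono_left nhdsWithin_le_nhds) ?_
    filter_upwards [self_mem_nhdsWithin] with p hp
    exact ⟨⟨ha.trans_le hp.1, hp.2⟩, hq₀⟩
  have hlsc : ∀ y, y < -Ψ (p₀, q₀) → ∀ᶠ t in 𝓝[Set.Icc a 1] p₀, y < -Ψ (t, q₀) := by
    intro y hy
    have h := husc (-y) (by linarith)
    filter_upwards [hslice.eventually h] with t ht
    linarith
  have h := (continuousWithinAt_Icc_left_of_monotoneOn hmono hx hlsc).neg
  -- back to `Ψ`
  refine h.congr (fun p _ => ?_) ?_ <;> simp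

/-- **`ψ⁰(p₀,·)` is RIGHT-continuous in `q`** on `[1,∞)` (`0 < p₀ ≤ 1`, `d ≥ 1`): upper semicontinuity plus the
non-decrease in `q` (`DecayRateMonotone.lean`). [cite: Grimmett2006, Cor. (5.45), Prop. (4.28)(c)] -/
theorem continuousWithinAt_Icc_right_radiusDecayRate_rcLimit_false_q (k : Fin d) {Ψ : ℝ × ℝ → ℝ}
    (hΨ : ∀ x ∈ Set.Ioc (0 : ℝ) 1 ×ˢ Set.Ici (1 : ℝ), Tendsto (fun n : ℕ =>
      -Real.log ((rcLimit d false x.1 x.2).real (siteToBoundary d n)) / n) atTop (𝓝 (Ψ x)))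
    {p₀ q₀ b : ℝ} (hp₀ : p₀ ∈ Set.Ioc (0 : ℝ) 1) (hq₀ : 1 ≤ q₀) (hb : q₀ ≤ b) :
    ContinuousWithinAt (fun q => Ψ (p₀, q)) (Set.Icc q₀ b) q₀ := by
  have hmono : MonotoneOn (fun q => Ψ (p₀, q)) (Set.Icc 1 b) := by
    intro q hq q' hq' hqq'
    exact radiusDecayRate_rcLimit_mono_right false hp₀ hq.1 hqq' k
      (hΨ (p₀, q') ⟨hp₀, hq'.1⟩) (hΨ (p₀, q) ⟨hp₀, hq.1⟩)
  have hx : q₀ ∈ Set.Icc 1 b := ⟨hq₀, hb⟩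
  have husc := upperSemicontinuousWithinAt_radiusDecayRate_rcLimit_false k hΨ (x₀ := (p₀, q₀)) ⟨hp₀, hq₀⟩
  have hslice : Tendsto (fun q : ℝ => (p₀, q)) (𝓝[Set.Icc 1 b] q₀)
      (𝓝[Set.Ioc (0 : ℝ) 1 ×ˢ Set.Ici (1 : ℝ)] (p₀, q₀)) := by
    refine tendsto_nhdsWithin_of_tendsto_nhds_of_eventually_within _
      ((Continuous.prodMk_right p₀).tendsto q₀ |>.mono_left nhdsWithin_le_nhds) ?_
    filter_upwards [self_mem_nhdsWithin] with q hq
    exact ⟨hp₀, hq.1⟩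
  have husc' : ∀ y, Ψ (p₀, q₀) < y → ∀ᶠ t in 𝓝[Set.Icc 1 b] q₀, Ψ (p₀, t) < y := by
    intro y hy
    filter_upwards [hslice.eventually (husc y hy)] with t ht
    exact ht
  exact continuousWithinAt_Icc_right_of_monotoneOn hmono hx husc'

end Summit.CriticalPhenomena.PercolationContinuityZ3.Theorems.FK

end
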